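import Literature.NumberTheory.EllipticCurves.EichlerShimuraConstructionLatticeProofs
import Literature.NumberTheory.EllipticCurves.LatticeHomOfCurveKernelProofs
import Literature.NumberTheory.EllipticCurves.EichlerShimuraMapDegree
import HarnessLib

/-!
# The degree of a `ℚ`-isogeny is the index of the period lattices under its rational multiplier

Topic `NumberTheory/EllipticCurves`; a proofs-only file (theorems only: no definitions, no named
facts, nothing restated; D-0026), written for the discharge programme of the named fact
`Literature.NumberTheory.EllipticCurves.ModularForms.PastenShimura2024_minimalDegree_le_163_mul`
(`PastenSpectralDegree.lean`; Pasten 2024, §3 p. 13: a minimal isogeny `A_{1,N} → E` has degree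
`≤ 163` by Mazur–Kenku), whose reduction (`PastenSpectralDegreeIsogenyBoundProofs.lean`) needs
the passage from a `ℚ`-isogeny of degree `d` (as supplied by the tree's Mazur–Kenku fact
`mazurKenku_exists_cyclic_isogeny`; `Isogeny.degree = #ker` on `ℚ̄`-points) to a **rational**
multiplier `q` of the period lattices with `[Λ' : qΛ] = d`, in the currency of the modular
parametrisation files (`mulQuotientMap`, the isogeny `z ↦ cz : ℂ/Λ₁ → ℂ/Λ₂` of
`EichlerShimuraMapDegree.lean`). The two ingredients are theorems of the tree:
`PeriodPair.exists_mul_of_curve_hom_card_ker` (`LatticeHomOfCurveKernelProofs.lean`: Silverman,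
*AEC*, Thm. VI.4.1(b) with `#ker φ = [Λ₂ : αΛ₁]`, III.4.10(c)) and the Galois-descent argument
of `neronLattice_commensurable_of_isogeny_of_baseChange_eq_curve`
(`EichlerShimuraConstructionLatticeProofs.lean`: `α ∈ ℚ` for a `ℚ`-isogeny, *AEC* III.5), which
is re-run here because that theorem exports only *some* nonzero integer multiple `aΛ ⊆ Λ'` and
discards the multiplier of `ψ`.

* `natCard_ker_mulQuotientMap_eq_relIndex` — `#ker(z ↦ cz : ℂ/Λ₁ → ℂ/Λ₂) = [c⁻¹Λ₂ : Λ₁]`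
  (`AddSubgroup.relIndex`), for any subgroups `Λ₁, Λ₂` of `ℂ` with `cΛ₁ ⊆ Λ₂`.
* `degree_eq_natCard_ker_mulQuotientMap_of_baseChange_eq_curve` — **for a `ℚ`-isogeny
  `ψ : E → E'` between `ℚ`-models of `E_Λ`, `E_{Λ'}` there is `q ∈ ℚ^*` with `qΛ ⊆ Λ'` and
  `deg ψ = #ker(z ↦ qz : ℂ/Λ → ℂ/Λ') = [Λ' : qΛ]`.**

## References

* J. H. Silverman, *The Arithmetic of Elliptic Curves*, 2nd ed., GTM 106, Springer 2009:
  Thm. VI.4.1 (PDF pp. 152–154), III.4.10(c) (PDF p. 72), III.5 (PDF p. 75), Thm. VI.5.3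
  (PDF pp. 155–156). [SilvermanAEC2009]
-/

noncomputable section

namespace Literature.NumberTheory.EllipticCurves.ModularForms

open scoped Classical
open _root_.WeierstrassCurve _root_.PeriodPair

/-! ### The kernel of `z ↦ c z` as a relative index -/

/-- **`#ker(z ↦ cz : ℂ/Λ₁ → ℂ/Λ₂) = [c⁻¹Λ₂ : Λ₁]`.** For subgroups `Λ₁, Λ₂ ≤ ℂ` and `c` with
`cΛ₁ ⊆ Λ₂`, the kernel of `mulQuotientMap Λ₁ Λ₂ c` is `c⁻¹Λ₂/Λ₁`
(`QuotientAddGroup.ker_map`), whose order is the relative index of `Λ₁` in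
`c⁻¹Λ₂ = Λ₂.comap (c · )` (`AddSubgroup.index_ker` for `c⁻¹Λ₂ → ℂ/Λ₁`). (Silverman, *AEC*,
Thm. VI.4.1: `ker φ_c = c⁻¹Λ₂/Λ₁`.) [folklore] -/
theorem natCard_ker_mulQuotientMap_eq_relIndex {Λ₁ Λ₂ : AddSubgroup ℂ} {c : ℂ}
    {hc : ∀ z ∈ Λ₁, c * z ∈ Λ₂} :
    Nat.card (mulQuotientMap Λ₁ Λ₂ c hc).ker =
      Λ₁.relIndex (Λ₂.comap (AddMonoidHom.mulLeft c)) := by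
  set K : AddSubgroup ℂ := Λ₂.comap (AddMonoidHom.mulLeft c) with hK
  have hker : (mulQuotientMap Λ₁ Λ₂ c hc).ker = K.map (QuotientAddGroup.mk' Λ₁) :=
    QuotientAddGroup.ker_map Λ₁ Λ₂ (AddMonoidHom.mulLeft c) fun z hz ↦ hc z hz
  set g : K →+ ℂ ⧸ Λ₁ := (QuotientAddGroup.mk' Λ₁).comp K.subtype with hg
  have hrange : g.range = K.map (QuotientAddGroup.mk' Λ₁) := by
    rw [hg, ← AddMonoidHom.map_range, AddSubgroup.range_subtype]
  have hgker : g.ker = Λ₁.addSubgroupOf K := by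
    ext z
    simp only [hg, AddMonoidHom.mem_ker, AddMonoidHom.coe_comp, Function.comp_apply,
      AddSubgroup.coe_subtype, QuotientAddGroup.mk'_apply, QuotientAddGroup.eq_zero_iff,
      AddSubgroup.mem_addSubgroupOf]
  rw [hker, ← hrange, ← AddSubgroup.index_ker, hgker, AddSubgroup.relIndex]

/-! ### `ℚ`-isogenies: degree = lattice index under the rational multiplier -/

/-- **The degree of a `ℚ`-isogeny between models of `E_Λ`, `E_{Λ'}` is the index `[Λ' : qΛ]`
under its rational multiplier `q`.**  Let `E, E'` be Weierstrass models over `ℚ` of elliptic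
curves with `E ⊗ ℂ = E_Λ`, `E' ⊗ ℂ = E_{Λ'}` (the curves `y² = x³ − (g₂/4)x − g₃/4` of the
period pairs `L, L'`), and `ψ : E → E'` an isogeny defined over `ℚ` (`WeierstrassCurve.Isogeny`).
Then there is `q ∈ ℚ`, `q ≠ 0`, with `qΛ ⊆ Λ'` and
`deg ψ = #ker ψ = #ker(z ↦ qz : ℂ/Λ → ℂ/Λ') = [Λ' : qΛ]` (Silverman, *AEC*, Thm. VI.4.1(b):
`ψ` is `φ_α`, `αΛ ⊆ Λ'`, on `ℂ/Λ → ℂ/Λ'`, and `#ker φ_α = [Λ' : αΛ]`, III.4.10(c) — the tree's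
`PeriodPair.exists_mul_of_curve_hom_card_ker`; III.5: `ψ^*ω' = αω`, so `α ∈ ℚ` for
`ψ, ω, ω'` over `ℚ`).  Steps 0–9 are the proof of the tree's
`neronLattice_commensurable_of_isogeny_of_baseChange_eq_curve` verbatim (transport along
`ι : ℚ̄ → ℂ`, all torsion in the image, the analytic theorem — here with the kernel count —,
and Galois descent of `α = (N/D)(P₀)` through the conjugate rational representations); step 10
converts `[Λ' : qΛ]` into the kernel of `mulQuotientMap`
(`PeriodPair.relIndex_mulLeft_eq_relIndex_comap`, `natCard_ker_mulQuotientMap_eq_relIndex`).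
[cite: SilvermanAEC2009, Thm. VI.4.1(b) (PDF pp. 152–154), III.4.10(c), III.5 (PDF p. 75)] -/
theorem degree_eq_natCard_ker_mulQuotientMap_of_baseChange_eq_curve {E E' : WeierstrassCurve ℚ}
    [E.IsElliptic] [E'.IsElliptic] (ψ : Isogeny E E') {L L' : PeriodPair}
    (hE : E.baseChange ℂ = L.curve) (hE' : E'.baseChange ℂ = L'.curve) :
    ∃ q : ℚ, q ≠ 0 ∧ ∃ hq : ∀ z ∈ L.lattice, ((q : ℂ) * z) ∈ L'.lattice,
      ψ.degree =
        Nat.card (mulQuotientMap L.lattice.toAddSubgroup L'.lattice.toAddSubgroup (q : ℂ) hq).ker := by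
  classical
  -- Step 0: the coefficients `a₁, a₃` of `E'` vanish (it is a model of `E_{Λ'}`)
  have ha₁' : E'.a₁ = 0 := by
    have h := congrArg WeierstrassCurve.a₁ hE'
    simpa [WeierstrassCurve.baseChange] using h
  have ha₃' : E'.a₃ = 0 := by
    have h := congrArg WeierstrassCurve.a₃ hE'
    simpa [WeierstrassCurve.baseChange] using h
  -- Step 1: the embedding `ι : ℚ̄ → ℂ` and the point maps `f, f'`
  set ι : AlgebraicClosure ℚ →ₐ[ℚ] ℂ :=
    (@IsAlgClosed.lift ℂ _ _ ℚ _ _ (AlgebraicClosure ℚ) _ _ (AlgebraicClosure.instAlgebra ℚ) _ _ _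
      (AlgebraicClosure.isAlgebraic ℚ)) with hι
  set f : E.geomPoints →+ (E.baseChange ℂ).toAffine.Point :=
    WeierstrassCurve.Affine.Point.map (W' := E) ι with hf
  set f' : E'.geomPoints →+ (E'.baseChange ℂ).toAffine.Point :=
    WeierstrassCurve.Affine.Point.map (W' := E') ι with hf'
  have hfinj : Function.Injective f := WeierstrassCurve.Affine.Point.map_injective (W' := E) ι
  have hf'inj : Function.Injective f' := WeierstrassCurve.Affine.Point.map_injective (W' := E') ι
  set ιr : AlgebraicClosure ℚ →+* ℂ := (ι : AlgebraicClosure ℚ →+* ℂ) with hιr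
  have hιr_apply : ∀ a, ιr a = ι a := fun a ↦ rfl
  have heval : ∀ (P : MvPolynomial (Fin 2) (AlgebraicClosure ℚ)) (x y : AlgebraicClosure ℚ),
      MvPolynomial.eval ![ι x, ι y] (MvPolynomial.map ιr P) = ι (MvPolynomial.eval ![x, y] P) := by
    intro P x y
    have hv : (⇑ιr) ∘ ![x, y] = ![ι x, ι y] := by
      funext i
      fin_cases i <;> rfl
    rw [← hιr_apply (MvPolynomial.eval ![x, y] P), MvPolynomial.map_eval ιr ![x, y] P, hv]
  have hfsome : ∀ {x y : AlgebraicClosure ℚ}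
      (h : (E.baseChange (AlgebraicClosure ℚ)).toAffine.Nonsingular x y),
      ∃ hns, f (.some x y h) = .some (ι x) (ι y) hns := fun h ↦
    ⟨_, WeierstrassCurve.Affine.Point.map_some ι h⟩
  -- Step 2: every rational representation of `ψ` survives the transport along `ι`
  have htrans : ∀ ρ : RatRep E E' ψ,
      {m : E.geomPoints | ¬ ∃ (x y : ℂ) (h : (E.baseChange ℂ).toAffine.Nonsingular x y),
        f m = .some x y h ∧ MvPolynomial.eval ![x, y] (MvPolynomial.map ιr ρ.Q₁) ≠ 0 ∧
        MvPolynomial.eval ![x, y] (MvPolynomial.map ιr ρ.Q₂) ≠ 0 ∧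
        ∃ h' : (E'.baseChange ℂ).toAffine.Nonsingular
            (MvPolynomial.eval ![x, y] (MvPolynomial.map ιr ρ.P₁) /
              MvPolynomial.eval ![x, y] (MvPolynomial.map ιr ρ.Q₁))
            (MvPolynomial.eval ![x, y] (MvPolynomial.map ιr ρ.P₂) /
              MvPolynomial.eval ![x, y] (MvPolynomial.map ιr ρ.Q₂)),
          f' (ψ.toAddMonoidHom m) = .some _ _ h'}.Finite := by
    intro ρ
    refine ρ.finite_setOf_not_agrees.subset fun m hm hagree ↦ hm ?_
    obtain ⟨x, y, h, hPm, hQ₁, hQ₂, h', hφP⟩ := hagree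
    have hns : (E.baseChange ℂ).toAffine.Nonsingular (ι x) (ι y) :=
      (E.toAffine.baseChange_nonsingular ι.injective x y).mpr h
    have hns' := (E'.toAffine.baseChange_nonsingular ι.injective _ _).mpr h'
    have hfm : f m = .some (ι x) (ι y) hns := by
      rw [hPm]; exact WeierstrassCurve.Affine.Point.map_some ι h
    have hfφ : f' (ψ.toAddMonoidHom m) =
        .some (ι (MvPolynomial.eval ![x, y] ρ.P₁ / MvPolynomial.eval ![x, y] ρ.Q₁))
          (ι (MvPolynomial.eval ![x, y] ρ.P₂ / MvPolynomial.eval ![x, y] ρ.Q₂)) hns' := by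
      rw [Isogeny.coe_toAddMonoidHom, hφP]; exact WeierstrassCurve.Affine.Point.map_some ι h'
    obtain ⟨h'', he⟩ := WeierstrassCurve.Affine.Point.exists_eq_some_of_eq hfφ
      (a' := MvPolynomial.eval ![ι x, ι y] (MvPolynomial.map ιr ρ.P₁) /
        MvPolynomial.eval ![ι x, ι y] (MvPolynomial.map ιr ρ.Q₁))
      (b' := MvPolynomial.eval ![ι x, ι y] (MvPolynomial.map ιr ρ.P₂) /
        MvPolynomial.eval ![ι x, ι y] (MvPolynomial.map ιr ρ.Q₂))
      (by rw [map_div₀, heval, heval]) (by rw [map_div₀, heval, heval])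
    refine ⟨ι x, ι y, hns, hfm, ?_, ?_, h'', he⟩
    · rw [heval]; exact (map_ne_zero ι).2 hQ₁
    · rw [heval]; exact (map_ne_zero ι).2 hQ₂
  -- Step 3: all torsion of `E_Λ(ℂ)` comes from `E(ℚ̄)` (both `n`-torsion groups have `n²` elements)
  have htors : ∀ n : ℕ, 0 < n → ∀ P : (E.baseChange ℂ).toAffine.Point, n • P = 0 →
      P ∈ f.range := by
    intro n hn P hP
    haveI : (E.baseChange (AlgebraicClosure ℚ)).IsElliptic := by
      rw [WeierstrassCurve.baseChange]; infer_instance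
    haveI : (E.baseChange ℂ).IsElliptic := by
      rw [WeierstrassCurve.baseChange]; infer_instance
    have h1 : Nat.card (AddSubgroup.torsionBy E.geomPoints (n : ℤ)) = n ^ 2 :=
      WeierstrassCurve.card_torsionBy_eq_sq (E := E.baseChange (AlgebraicClosure ℚ))
        (by exact_mod_cast hn.ne')
    have h2 : Nat.card (AddSubgroup.torsionBy (E.baseChange ℂ).toAffine.Point (n : ℤ)) = n ^ 2 :=
      WeierstrassCurve.card_torsionBy_eq_sq (E := E.baseChange ℂ) (by exact_mod_cast hn.ne')
    set T₁ : Set E.geomPoints :=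
      (AddSubgroup.torsionBy E.geomPoints (n : ℤ) : Set E.geomPoints) with hT₁
    set T₂ : Set (E.baseChange ℂ).toAffine.Point :=
      (AddSubgroup.torsionBy (E.baseChange ℂ).toAffine.Point (n : ℤ) :
        Set (E.baseChange ℂ).toAffine.Point) with hT₂
    have hsub : f '' T₁ ⊆ T₂ := by
      rintro _ ⟨m, hm, rfl⟩
      simp only [hT₁, hT₂, SetLike.mem_coe, AddSubgroup.torsionBy.nsmul_iff] at hm ⊢
      rw [← map_nsmul, hm, map_zero]
    have hT₂fin : T₂.Finite := by
      have : Finite (AddSubgroup.torsionBy (E.baseChange ℂ).toAffine.Point (n : ℤ)) :=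
        Nat.finite_of_card_ne_zero (by rw [h2]; exact pow_ne_zero 2 hn.ne')
      exact Set.toFinite _
    have hcard : T₂.ncard ≤ (f '' T₁).ncard := by
      rw [Set.ncard_image_of_injective _ hfinj, ← Nat.card_coe_set_eq, ← Nat.card_coe_set_eq]
      exact (h2.trans h1.symm).le
    have heq : f '' T₁ = T₂ := Set.eq_of_subset_of_ncard_le hsub hcard hT₂fin
    have hP' : P ∈ T₂ := by
      simpa only [hT₂, SetLike.mem_coe, AddSubgroup.torsionBy.nsmul_iff] using hP
    rw [← heq] at hP'
    obtain ⟨m, -, hm⟩ := hP'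
    exact ⟨m, hm⟩
  -- Step 4: the analytic theorem
  set ρ₀ : RatRep E E' ψ := ψ.ratRep with hρ₀
  obtain ⟨α, hα0, hαΛ, hidx, hformula⟩ := PeriodPair.exists_mul_of_curve_hom_card_ker L L'
    ψ.toAddMonoidHom ψ.finite_ker hE hE' f hfinj f' hf'inj htors (MvPolynomial.map ιr ρ₀.P₁)
    (MvPolynomial.map ιr ρ₀.Q₁) (MvPolynomial.map ιr ρ₀.P₂) (MvPolynomial.map ιr ρ₀.Q₂) (htrans ρ₀)
  -- Step 5: the identity `α · D(P) = N(P)` at `ℚ̄`-points, for every representation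
  have hEQmap : (E.baseChange (AlgebraicClosure ℚ)).map ιr = E.baseChange ℂ := by
    simp only [WeierstrassCurve.baseChange, WeierstrassCurve.map_map]
    congr 1
    ext a
    simp
  have hkey : ∀ (ρ : RatRep E E' ψ) (x y : AlgebraicClosure ℚ)
      (h : (E.baseChange (AlgebraicClosure ℚ)).toAffine.Nonsingular x y),
      α * ι (MvPolynomial.eval ![x, y] (MvPolynomial.C 2 * ρ.P₂ * ρ.Q₁ ^ 2)) =
        ι (MvPolynomial.eval ![x, y]
          (((E.baseChange (AlgebraicClosure ℚ)).invariantDerivation ρ.P₁ * ρ.Q₁ - ρ.P₁ * (E.baseChange (AlgebraicClosure ℚ)).invariantDerivation ρ.Q₁) * ρ.Q₂)) := by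
    intro ρ x y h
    obtain ⟨hns, hfm⟩ := hfsome h
    have H := hformula (MvPolynomial.map ιr ρ.P₁) (MvPolynomial.map ιr ρ.Q₁)
      (MvPolynomial.map ιr ρ.P₂) (MvPolynomial.map ιr ρ.Q₂) (htrans ρ) _ _ _ hns hfm
    have e1 : MvPolynomial.C 2 * MvPolynomial.map ιr ρ.P₂ * MvPolynomial.map ιr ρ.Q₁ ^ 2 =
        MvPolynomial.map ιr (MvPolynomial.C 2 * ρ.P₂ * ρ.Q₁ ^ 2) := by
      simp only [map_mul, map_pow, map_ofNat]
    have e2 : ((E.baseChange ℂ).invariantDerivation (MvPolynomial.map ιr ρ.P₁) *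
          MvPolynomial.map ιr ρ.Q₁ -
        MvPolynomial.map ιr ρ.P₁ * (E.baseChange ℂ).invariantDerivation (MvPolynomial.map ιr ρ.Q₁)) *
          MvPolynomial.map ιr ρ.Q₂ =
        MvPolynomial.map ιr
          (((E.baseChange (AlgebraicClosure ℚ)).invariantDerivation ρ.P₁ * ρ.Q₁ - ρ.P₁ * (E.baseChange (AlgebraicClosure ℚ)).invariantDerivation ρ.Q₁) * ρ.Q₂) := by
      rw [← hEQmap, WeierstrassCurve.invariantDerivation_map,
        WeierstrassCurve.invariantDerivation_map]
      simp only [map_mul, map_sub]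
    rw [e1, e2, heval, heval] at H
    exact H
  -- Step 6: a good point `P₀ = (x₀, y₀)`: off the exceptional set of `ρ₀`, `ψ P₀ ∉ E'[2]`
  have hE2fin : {m : E.geomPoints | (2 : ℕ) • ψ m = 0}.Finite := by
    haveI : (E'.baseChange (AlgebraicClosure ℚ)).IsElliptic := by
      rw [WeierstrassCurve.baseChange]; infer_instance
    have hcard : Nat.card (AddSubgroup.torsionBy E'.geomPoints ((2 : ℕ) : ℤ)) = 2 ^ 2 :=
      WeierstrassCurve.card_torsionBy_eq_sq (E := E'.baseChange (AlgebraicClosure ℚ)) (n := 2)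
        (by norm_num)
    have hfin2 : (AddSubgroup.torsionBy E'.geomPoints ((2 : ℕ) : ℤ) : Set E'.geomPoints).Finite := by
      have : Finite (AddSubgroup.torsionBy E'.geomPoints ((2 : ℕ) : ℤ)) :=
        Nat.finite_of_card_ne_zero (by rw [hcard]; norm_num)
      exact Set.toFinite _
    have hpre := PeriodPair.finite_preimage_of_finite_ker ψ.toAddMonoidHom ψ.finite_ker hfin2
    refine hpre.subset fun m hm ↦ ?_
    simp only [Set.mem_setOf_eq] at hm
    simp only [Set.mem_preimage, SetLike.mem_coe, AddSubgroup.torsionBy.nsmul_iff,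
      Isogeny.coe_toAddMonoidHom]
    exact hm
  obtain ⟨P₀, hP₀⟩ := Infinite.exists_notMem_finset ((ρ₀.exc : Finset E.geomPoints) ∪ hE2fin.toFinset)
  rw [Finset.mem_union, not_or] at hP₀
  obtain ⟨hP₀exc, hP₀2⟩ := hP₀
  have hP₀2' : ¬ (2 : ℕ) • ψ P₀ = 0 := fun h ↦ hP₀2 (hE2fin.mem_toFinset.2 h)
  -- `P₀` is affine
  obtain ⟨x₀, y₀, h₀, rfl⟩ : ∃ x₀ y₀ h₀, P₀ = .some x₀ y₀ h₀ := by
    change (E.baseChange (AlgebraicClosure ℚ)).toAffine.Point at P₀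
    rcases P₀ with _ | ⟨x₀, y₀, h₀⟩
    · exact (hP₀exc ρ₀.zero_mem_exc).elim
    · exact ⟨x₀, y₀, h₀, rfl⟩
  obtain ⟨hQ₁0, hQ₂0, h₀', hψP₀⟩ := ρ₀.apply_eq_of_not_mem_exc h₀ hP₀exc
  -- `p₂(P₀) ≠ 0`, for otherwise `ψ P₀ = (x', 0)` would be `2`-torsion
  have hP₂0 : MvPolynomial.eval ![x₀, y₀] ρ₀.P₂ ≠ 0 := by
    intro h0
    apply hP₀2'
    have hy : MvPolynomial.eval ![x₀, y₀] ρ₀.P₂ / MvPolynomial.eval ![x₀, y₀] ρ₀.Q₂ = 0 := by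
      rw [h0, zero_div]
    rw [hψP₀]
    exact two_nsmul_eq_zero_of_y_eq_zero (W := E') ha₁' ha₃' h₀' hy
  set D₀ : AlgebraicClosure ℚ := MvPolynomial.eval ![x₀, y₀] (MvPolynomial.C 2 * ρ₀.P₂ * ρ₀.Q₁ ^ 2)
    with hD₀
  set N₀ : AlgebraicClosure ℚ := MvPolynomial.eval ![x₀, y₀]
      (((E.baseChange (AlgebraicClosure ℚ)).invariantDerivation ρ₀.P₁ * ρ₀.Q₁ - ρ₀.P₁ * (E.baseChange (AlgebraicClosure ℚ)).invariantDerivation ρ₀.Q₁) * ρ₀.Q₂)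
    with hN₀
  have hD₀ne : D₀ ≠ 0 := by
    simp only [hD₀, map_mul, map_pow, MvPolynomial.eval_C]
    exact mul_ne_zero (mul_ne_zero two_ne_zero hP₂0) (pow_ne_zero 2 hQ₁0)
  -- Step 7: `α = ι α₀`, `α₀ = N₀ / D₀ ∈ ℚ̄`
  set α₀ : AlgebraicClosure ℚ := N₀ / D₀ with hα₀
  have hαι : α = ι α₀ := by
    have H := hkey ρ₀ x₀ y₀ h₀
    rw [hα₀, map_div₀, eq_div_iff ((map_ne_zero ι).2 hD₀ne)]
    exact H
  -- Step 8: `α₀` is fixed by `Γ_ℚ`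
  have hfix : ∀ σ : Field.absoluteGaloisGroup ℚ,
      Field.absoluteGaloisGroup.toAlgEquiv ℚ σ α₀ = α₀ := by
    intro σ
    set τ : AlgebraicClosure ℚ ≃ₐ[ℚ] AlgebraicClosure ℚ :=
      Field.absoluteGaloisGroup.toAlgEquiv ℚ σ with hτ
    set ρσ : RatRep E E' ψ := ρ₀.conj σ (fun P ↦ ψ.map_smul σ P) with hρσ
    -- the conjugate point `σ • P₀ = (σ x₀, σ y₀)`
    obtain ⟨hσns, eσ⟩ := geomPoints.smul_some (W := E) σ h₀
    have H := hkey ρσ _ _ hσns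
    -- the polynomials of `ρσ` are the conjugates, and `δ` commutes with conjugation
    have hEQσ : (E.baseChange (AlgebraicClosure ℚ)).map (RatRep.galHom σ) =
        E.baseChange (AlgebraicClosure ℚ) := by
      simp only [WeierstrassCurve.baseChange, WeierstrassCurve.map_map]
      congr 1
      ext a
      simp
    have e1 : MvPolynomial.C 2 * ρσ.P₂ * ρσ.Q₁ ^ 2 =
        MvPolynomial.map (RatRep.galHom σ) (MvPolynomial.C 2 * ρ₀.P₂ * ρ₀.Q₁ ^ 2) := by
      simp only [hρσ, RatRep.conj_P₂, RatRep.conj_Q₁, map_mul, map_pow, map_ofNat]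
    have e2 : ((E.baseChange (AlgebraicClosure ℚ)).invariantDerivation ρσ.P₁ * ρσ.Q₁ -
          ρσ.P₁ * (E.baseChange (AlgebraicClosure ℚ)).invariantDerivation ρσ.Q₁) * ρσ.Q₂ =
        MvPolynomial.map (RatRep.galHom σ)
          (((E.baseChange (AlgebraicClosure ℚ)).invariantDerivation ρ₀.P₁ * ρ₀.Q₁ -
            ρ₀.P₁ * (E.baseChange (AlgebraicClosure ℚ)).invariantDerivation ρ₀.Q₁) * ρ₀.Q₂) := by
      simp only [hρσ, RatRep.conj_P₁, RatRep.conj_Q₁, RatRep.conj_Q₂]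
      conv_lhs => rw [← hEQσ]
      rw [WeierstrassCurve.invariantDerivation_map, WeierstrassCurve.invariantDerivation_map]
      simp only [map_mul, map_sub]
    rw [e1, e2, ← RatRep.galois_eval_vec₂, ← RatRep.galois_eval_vec₂] at H
    -- so `α = ι (τ N₀) / ι (τ D₀) = ι (τ α₀)`
    have hτD : τ D₀ ≠ 0 := (map_ne_zero τ).2 hD₀ne
    have hα' : α = ι (τ α₀) := by
      rw [hα₀, map_div₀, map_div₀, eq_div_iff ((map_ne_zero ι).2 hτD)]
      exact H
    have : ι (τ α₀) = ι α₀ := hα'.symm.trans hαι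
    exact ι.injective this
  -- Step 9: Galois descent: `α₀ ∈ ℚ`
  obtain ⟨q, hq⟩ := exists_algebraMap_eq_of_forall_absoluteGaloisGroup hfix
  have hαq : α = (q : ℂ) := by
    rw [hαι, ← hq, eq_ratCast, map_ratCast]
  have hq0 : q ≠ 0 := by
    rintro rfl
    exact hα0 (by rw [hαq, Rat.cast_zero])
  -- Step 10: `deg ψ = #ker ψ = [Λ' : qΛ] = #ker(z ↦ q z)`
  subst hαq
  refine ⟨q, hq0, hαΛ, ?_⟩
  rw [natCard_ker_mulQuotientMap_eq_relIndex, ← PeriodPair.relIndex_mulLeft_eq_relIndex_comap hα0,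
    hidx]
  rfl

end Literature.NumberTheory.EllipticCurves.ModularForms

end
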